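import Summits.ABC.StewartYu.PadicTwistPMMain
import HarnessLib

/-!
# Cell abc-stewartyu, WP-Y provider B (xvii): parameter packs for the ± chain

`Summits/ABC/StewartYu/PadicTwistPMAssembly.lean` — cell `abc-stewartyu`, seat p3 (crux `W80OneModFour`
stmt-ABC-19487). Twin of the first part of p2's `PadicTwistAssembly.lean`: the package `ParamPackPM U` of
everything `main_pm` needs (KSizes/KFinal — p2's, shared —, `HalfStepPM`, `SiegelPM`, `EndgamePM`),
`not_norm_Λ₀_le_of_paramPackPM`, monotonicity in `U`. The providers are landed: `halfStep_pm_of`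
(PMHalfStep), `siegelPM_of_siegel` (PMAdapters), `endgamePM_of_numbers` (PMMain). [cite: Yu1990, Proposition 2.1]
[cite: Waldschmidt1980, §§3.2–3.5 (pp. 264–274)].
-/

noncomputable section

open NormedSpace Finset IsUltrametricDist
open Literature.NumberTheory.Transcendental
open Literature.NumberTheory.Transcendental.CW77.Setup (Idx Tau tauNorm)
open scoped Nat

namespace Summit.ABC.StewartYu

namespace TwistSetup

variable {p : ℕ} [Fact p.Prime] (S : TwistSetup p)

/-- **A parameter pack for the twisted set-up `S` at exponent `U`**: box parameters `h, Lb`, descent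
parameters `J₀, L, L_θ, S₀, T, P, t`, size functions `Dmax, Mmax`, and the inputs of
`TwistSetup.main`: `S₀` even, `1 ≤ t J`, `(d+1) t J ≤ ⌊T/2^J⌋`, `log p ≤ U`, the sizes `KSizes`,
Siegel on a class at level `0`, the endgame at level `J₀`, and — under `‖Λ₀‖_p ≤ e^{−U}` — the
inequalities `KFinal` and the classed half steps. [cite: Yu1990, Proposition 2.1]
[cite: Waldschmidt1980, §§3.2–3.5 (pp. 264–274)] -/
structure ParamPackPM (U : ℝ) where
  /-- `h`: number of `Δ`-polynomials `Δ(X;r)`, `r < h` -/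
  h : ℕ
  /-- `Lb`: range of the exponent of `Δ(X;h)` -/
  Lb : ℕ
  /-- the depth of the descent -/
  J₀ : ℕ
  /-- ranges of the free exponents -/
  L : Fin S.d → ℕ
  /-- range of the eliminated exponent -/
  Lθ : ℕ
  /-- number of points at level `0` -/
  S₀ : ℕ
  /-- number of derivatives at level `0` -/
  T : ℕ
  /-- the integer bound for the coefficients -/
  P : ℤ
  /-- multiplicity of the inner steps at level `J` -/
  t : ℕ → ℕ
  /-- denominator bounds `Dmax J k` -/
  Dmax : ℕ → ℕ → ℝ
  /-- archimedean size bounds `Mmax J k` -/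
  Mmax : ℕ → ℕ → ℝ
  /-- `S₀` is even -/
  hS₀ : Even S₀
  /-- `t J ≥ 1` -/
  ht : ∀ J, J < J₀ → 1 ≤ t J
  /-- room for the inner chain -/
  htT : ∀ J, J < J₀ → (S.d + 1) * t J ≤ T / 2 ^ J
  /-- `log p ≤ U` (so that `e^{−U} ≤ p⁻¹`) -/
  hUp : Real.log p ≤ U
  /-- the archimedean sizes of the cores at every level -/
  hsz : ∀ J, J < J₀ → ∀ pv : Idx S.d h Lb → ℤ, S.InvPM J₀ L Lθ S₀ T P J pv →
    S.KSizes J₀ J L Lθ S₀ T (t J) pv (Dmax J) (Mmax J)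
  /-- the numerical inequalities of the inner steps, from the smallness of `Λ₀` -/
  hfin : ‖S.Λ₀‖ ≤ Real.exp (-U) → ∀ J, J < J₀ → S.KFinal (h := h) (Lb := Lb) J S₀ (t J) (Dmax J) (Mmax J)
  /-- the classed half steps, from the smallness of `Λ₀` -/
  hhalf : ‖S.Λ₀‖ ≤ Real.exp (-U) → ∀ J, J < J₀ → S.HalfStepPM (h := h) (Lb := Lb) J₀ J L Lθ S₀ T (t J) P
  /-- Siegel's lemma on a class at level `0` -/
  hsiegel : S.SiegelPM (h := h) (Lb := Lb) J₀ L Lθ S₀ T P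
  /-- the contradiction at level `J₀` -/
  hend : S.EndgamePM (h := h) (Lb := Lb) J₀ L Lθ S₀ T P

/-- **A parameter pack at exponent `U` forbids `‖Λ₀‖_p ≤ e^{−U}`.** [cite: Yu1990, Proposition 2.1] -/
theorem not_norm_Λ₀_le_of_paramPackPM {U : ℝ} (pk : S.ParamPackPM U) : ¬ ‖S.Λ₀‖ ≤ Real.exp (-U) := by
  intro hle
  have hp0 : (0 : ℝ) < p := by linarith [S.one_lt_p]
  have hΛ : ‖S.Λ₀‖ ≤ (p : ℝ)⁻¹ := by
    refine hle.trans ?_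
    rw [← Real.exp_log hp0, ← Real.exp_neg, Real.exp_le_exp]
    exact neg_le_neg pk.hUp
  exact S.main_pm pk.hS₀ pk.ht pk.htT hΛ pk.hsz (pk.hfin hle) (pk.hhalf hle) pk.hsiegel pk.hend

/-- **Packs are monotone in the exponent.** [cite: Waldschmidt1980, Prop. 3.8 (p. 263)] -/
def ParamPackPM.mono {S : TwistSetup p} {U U' : ℝ} (pk : S.ParamPackPM U) (hU : U ≤ U') : S.ParamPackPM U' where
  h := pk.h
  Lb := pk.Lb
  J₀ := pk.J₀
  L := pk.L
  Lθ := pk.Lθ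
  S₀ := pk.S₀
  T := pk.T
  P := pk.P
  t := pk.t
  Dmax := pk.Dmax
  Mmax := pk.Mmax
  hS₀ := pk.hS₀
  ht := pk.ht
  htT := pk.htT
  hUp := pk.hUp.trans hU
  hsz := pk.hsz
  hfin hΛ := pk.hfin (hΛ.trans (Real.exp_le_exp.mpr (neg_le_neg hU)))
  hhalf hΛ := pk.hhalf (hΛ.trans (Real.exp_le_exp.mpr (neg_le_neg hU)))
  hsiegel := pk.hsiegel
  hend := pk.hend

/-- From a pack at any exponent `U ≤ U'`: `‖Λ₀‖_p > e^{−U'}`. [cite: Waldschmidt1980, Prop. 3.8] -/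
theorem norm_Λ₀_gt_of_paramPackPM_le {S : TwistSetup p} {U U' : ℝ} (hU : U ≤ U') (pk : S.ParamPackPM U) :
    Real.exp (-U') < ‖S.Λ₀‖ :=
  not_le.mp (S.not_norm_Λ₀_le_of_paramPackPM (pk.mono hU))


end TwistSetup

end Summit.ABC.StewartYu

end
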